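import Mathlib
import Summits.ValiantsHypothesis.ValiantsHypothesis.Cruxes.OrbitDimensionBound.Lines.GaugeLadder
import Summits.ValiantsHypothesis.ValiantsHypothesis.Cruxes.OrbitDimensionBound.Disproof

/-!
# SEPARATING WITNESS for the rung `Gauge.AffineGaugeShadow` (line `affine_gauge`): the rung's hypothesis class is
# STRICTLY larger than the floor's — affine gauge lifts a homothety that constant gauge cannot

The Koszul-twisted Grenet matrix `twistedGrenet = (1+V)·G₇·(1+U)` of `Disproof.lean` §4 (an affine determinantal
representation of `per₃` of the optimal size `7 = dc(per₃)`; the witness that refuted `UlrichPadded.NoTightInfinity`,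
negatives stmt-ValiantsHypothesis-5668):
* has NO constant lift of the homothety `x ↦ 2x` (`Disproof.twistedGrenet_no_homothety_lift`, landed) — so it is not
  `T_Λ`-equivariant in the floor's sense for ANY admissible `Λ` (`Disproof.homothety_mem_TΛ`);
* but lifts it with AFFINE UNIMODULAR gauge: `twistedGrenet(2x) · h = g · twistedGrenet(x)` with
  `g = (1+2V)·D·(1-V) = D + 2VD - DV`, `h = (1-2U)·D'·(1+U) = D' + D'U - 2UD'`, `D = diag(8,4,4,4,2,2,2)`,
  `D' = diag(1,4,4,4,2,2,2)` Grenet's level scalings, `det g = 4096`, `det h = 512` (this file, sorry-free).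
Hence `GaugeLifts 1 S B ∧ ¬ GaugeLifts 0 S B` on an honest representation of `per₃`: the gauge-degree dial MOVES at
its first notch, and the in-place obstruction of `Disproof.lean` §4 is a constant-gauge phenomenon.
[cite: LandsbergRessayre2017, Def. 1.3] [cite: Grenet2011, Thm. 1]
-/

set_option linter.dupNamespace false

namespace Summit.ValiantsHypothesis.ValiantsHypothesis.Cruxes.OrbitDimensionBound.Gauge.Witness

open MvPolynomial Matrix
open Literature.Computability.AlgebraicComplexity
open Summit.ValiantsHypothesis.ValiantsHypothesis.Cruxes.OrbitDimensionBound.Disproof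
open Summit.ValiantsHypothesis.ValiantsHypothesis.Cruxes.OrbitDimensionBound.Gauge

noncomputable section

/-- `twistedGrenet(2x)`. [folklore] -/
def twistedGrenet₂ : Matrix (Fin 7) (Fin 7) (MvPolynomial (Fin 3 × Fin 3) ℂ) :=
  !![0, C 2 * X (0,0), C 2 * X (1,0), C 2 * X (2,0), 0, 0, 0;
     0, 1, 0, 0, 0, C 2 * X (2,1), C 2 * X (1,1);
     0, -(C 2 * X (2,0)), 1, 0, C 2 * X (2,1), 0, C 2 * X (0,1);
     0, C 2 * X (1,0), 0, 1, C 2 * X (1,1), C 2 * X (0,1), 0;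
     C 2 * X (0,2), 0, 0, 0, 1, -(C 2 * X (2,2)), C 2 * X (1,2);
     C 2 * X (1,2), 0, 0, 0, 0, 1, 0;
     C 2 * X (2,2), 0, 0, 0, 0, 0, 1]

/-- The affine unimodular left gauge `g = D + 2VD - DV`. [folklore] -/
def gLift : Matrix (Fin 7) (Fin 7) (MvPolynomial (Fin 3 × Fin 3) ℂ) :=
  !![C 8, 0, 0, 0, 0, 0, 0;
     0, C 4, 0, 0, 0, 0, 0;
     0, 0, C 4, 0, 0, 0, 0;
     0, 0, 0, C 4, 0, 0, 0;
     0, 0, 0, 0, C 2, -(C 2 * X (2,2)), C 2 * X (1,2);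
     0, 0, 0, 0, 0, C 2, 0;
     0, 0, 0, 0, 0, 0, C 2]

/-- The affine unimodular right gauge `h = D' + D'U - 2UD'`. [folklore] -/
def hLift : Matrix (Fin 7) (Fin 7) (MvPolynomial (Fin 3 × Fin 3) ℂ) :=
  !![1, 0, 0, 0, 0, 0, 0;
     0, C 4, 0, 0, 0, 0, 0;
     0, C 4 * X (2,0), C 4, 0, 0, 0, 0;
     0, -(C 4 * X (1,0)), 0, C 4, 0, 0, 0;
     0, 0, 0, 0, C 2, 0, 0;
     0, 0, 0, 0, 0, C 2, 0;
     0, 0, 0, 0, 0, 0, C 2]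

/-- The homothety `x ↦ 2x` as a matrix: `2 · 1`. [folklore] -/
theorem coe_homothety_two :
    ((homothety 3 two : GL (Fin 3 × Fin 3) ℂ) : Matrix (Fin 3 × Fin 3) (Fin 3 × Fin 3) ℂ) =
      Matrix.diagonal (fun _ => (2 : ℂ)) := by
  simp [homothety, Grenet.val_diagUnit]

/-- The homothety substitution on a variable. [folklore] -/
theorem linSubst_homothety_two_X (v : Fin 3 × Fin 3) :
    linSubst (Fin 3 × Fin 3) ℂ ((homothety 3 two : GL (Fin 3 × Fin 3) ℂ) : Matrix _ _ ℂ) (X v) = C 2 * X v := by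
  rw [coe_homothety_two, Grenet.linSubst_diagonal_X, MvPolynomial.smul_eq_C_mul]

/-- The homothety substitution doubles every variable entry of the twisted Grenet matrix. [folklore] -/
theorem linSubstEntries_homothety_two :
    Matrix.linSubstEntries (homothety 3 two) twistedGrenet = twistedGrenet₂ := by
  refine Matrix.ext fun i j => ?_
  simp only [Matrix.linSubstEntries, Matrix.map_apply]
  fin_cases i <;> fin_cases j <;>
    simp [-linSubst_X, twistedGrenet, twistedGrenet₂, linSubst_homothety_two_X, map_neg]

set_option maxHeartbeats 4000000 in
/-- **The affine lift identity** `twistedGrenet(2x) · h = g · twistedGrenet(x)`. [folklore] -/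
theorem lift_identity : twistedGrenet₂ * hLift = gLift * twistedGrenet := by
  refine Matrix.ext fun i j => ?_
  fin_cases i <;> fin_cases j <;>
    simp [twistedGrenet, twistedGrenet₂, gLift, hLift, Matrix.mul_apply, Fin.sum_univ_seven, map_ofNat] <;> ring

/-- Total degree of `C c * X v` is at most one. [folklore] -/
theorem totalDegree_C_mul_X_le (c : ℂ) (v : Fin 3 × Fin 3) :
    (C c * X v : MvPolynomial (Fin 3 × Fin 3) ℂ).totalDegree ≤ 1 :=
  (totalDegree_mul _ _).trans (by simp [totalDegree_X])

/-- Total degree of a numeral is zero. [folklore] -/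
@[simp] theorem totalDegree_ofNat' (n : ℕ) [n.AtLeastTwo] :
    (OfNat.ofNat n : MvPolynomial (Fin 3 × Fin 3) ℂ).totalDegree = 0 := by
  rw [← map_ofNat (C : ℂ →+* MvPolynomial (Fin 3 × Fin 3) ℂ) n]
  exact totalDegree_C _

/-- Total degree of `n * X v` is at most one. [folklore] -/
@[simp] theorem totalDegree_ofNat_mul_X_le (n : ℕ) [n.AtLeastTwo] (v : Fin 3 × Fin 3) :
    ((OfNat.ofNat n : MvPolynomial (Fin 3 × Fin 3) ℂ) * X v).totalDegree ≤ 1 := by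
  rw [← map_ofNat (C : ℂ →+* MvPolynomial (Fin 3 × Fin 3) ℂ) n]
  exact totalDegree_C_mul_X_le _ v

/-- `g` is affine. [folklore] -/
theorem gLift_affine : ∀ i j, (gLift i j).totalDegree ≤ 1 := by
  intro i j
  fin_cases i <;> fin_cases j <;>
    simp [gLift, totalDegree_C, totalDegree_neg, totalDegree_C_mul_X_le]

/-- `h` is affine. [folklore] -/
theorem hLift_affine : ∀ i j, (hLift i j).totalDegree ≤ 1 := by
  intro i j
  fin_cases i <;> fin_cases j <;>
    simp [hLift, totalDegree_C, totalDegree_neg, totalDegree_C_mul_X_le]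

/-- `g` is upper triangular. [folklore] -/
theorem gLift_upper : gLift.BlockTriangular id := by
  intro i j hij
  fin_cases i <;> fin_cases j <;> simp at hij <;> simp [gLift]

/-- `hᵀ` is upper triangular. [folklore] -/
theorem hLift_transpose_upper : hLiftᵀ.BlockTriangular id := by
  intro i j hij
  fin_cases i <;> fin_cases j <;> simp at hij <;> simp [hLift, Matrix.transpose_apply]

/-- A numeral `≥ 2` is a unit polynomial over `ℂ`. [folklore] -/
theorem isUnit_ofNat' (n : ℕ) [n.AtLeastTwo] : IsUnit (OfNat.ofNat n : MvPolynomial (Fin 3 × Fin 3) ℂ) := by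
  rw [← map_ofNat (C : ℂ →+* MvPolynomial (Fin 3 × Fin 3) ℂ) n]
  exact (isUnit_iff_ne_zero.mpr (NeZero.ne _)).map C

/-- `det g = 8 · 4³ · 2³ = 4096` is a unit. [folklore] -/
theorem isUnit_det_gLift : IsUnit gLift.det := by
  rw [Matrix.det_of_upperTriangular gLift_upper, Fin.prod_univ_seven]
  have e : gLift 0 0 * gLift 1 1 * gLift 2 2 * gLift 3 3 * gLift 4 4 * gLift 5 5 * gLift 6 6 =
      (4096 : MvPolynomial (Fin 3 × Fin 3) ℂ) := by
    simp [gLift, map_ofNat]; norm_num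
  rw [e]; exact isUnit_ofNat' 4096

/-- `det h = 1 · 4³ · 2³ = 512` is a unit. [folklore] -/
theorem isUnit_det_hLift : IsUnit hLift.det := by
  rw [← Matrix.det_transpose, Matrix.det_of_upperTriangular hLift_transpose_upper, Fin.prod_univ_seven]
  have e : hLiftᵀ 0 0 * hLiftᵀ 1 1 * hLiftᵀ 2 2 * hLiftᵀ 3 3 * hLiftᵀ 4 4 * hLiftᵀ 5 5 * hLiftᵀ 6 6 =
      (512 : MvPolynomial (Fin 3 × Fin 3) ℂ) := by
    simp [hLift, Matrix.transpose_apply, map_ofNat]; norm_num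
  rw [e]; exact isUnit_ofNat' 512

/-- **The separating witness, unfolded form**: the homothety `x ↦ 2x` lifts on `twistedGrenet` with AFFINE unimodular
gauge — whereas `Disproof.twistedGrenet_no_homothety_lift` shows it has NO constant lift. [folklore] -/
theorem twistedGrenet_affine_homothety_lift :
    ∃ g h : Matrix (Fin 7) (Fin 7) (MvPolynomial (Fin 3 × Fin 3) ℂ),
      (∀ i j, (g i j).totalDegree ≤ 1) ∧ (∀ i j, (h i j).totalDegree ≤ 1) ∧
      IsUnit g.det ∧ IsUnit h.det ∧
      Matrix.linSubstEntries (homothety 3 two) twistedGrenet * h = g * twistedGrenet :=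
  ⟨gLift, hLift, gLift_affine, hLift_affine, isUnit_det_gLift, isUnit_det_hLift,
    by rw [linSubstEntries_homothety_two]; exact lift_identity⟩

/-- **`GaugeLifts 1` holds** for the homothety on the twisted Grenet matrix. [folklore] -/
theorem gaugeLifts_one_homothety_twistedGrenet :
    GaugeLifts 1 ({homothety 3 two} : Set (GL (Fin 3 × Fin 3) ℂ)) twistedGrenet := by
  intro γ hγ
  rw [Set.mem_singleton_iff] at hγ
  subst hγ
  exact twistedGrenet_affine_homothety_lift

/-- **`GaugeLifts 0` FAILS** for the homothety on the twisted Grenet matrix (= `Disproof.twistedGrenet_no_homothety_lift`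
through `gaugeLifts_zero_iff`). [folklore] -/
theorem not_gaugeLifts_zero_homothety_twistedGrenet :
    ¬ GaugeLifts 0 ({homothety 3 two} : Set (GL (Fin 3 × Fin 3) ℂ)) twistedGrenet := by
  intro h
  exact twistedGrenet_no_homothety_lift (((gaugeLifts_zero_iff _ _).mp h) _ (Set.mem_singleton _))

/-- **THE DIAL MOVES AT ITS FIRST NOTCH**: there is an affine determinantal representation of a permanent and a torus
substitution that lifts with gauge degree `1` but not with gauge degree `0` (the floor's constant lifts). [folklore] -/
theorem gauge_dial_strict :
    ∃ (n m : ℕ) (S : Set (GL (Fin n × Fin n) ℂ)) (B : Matrix (Fin m) (Fin m) (MvPolynomial (Fin n × Fin n) ℂ)),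
      IsAffineDetRepr (perPoly (Fin n) ℂ) B ∧ GaugeLifts 1 S B ∧ ¬ GaugeLifts 0 S B :=
  ⟨3, 7, {homothety 3 two}, twistedGrenet, isAffineDetRepr_twistedGrenet,
    gaugeLifts_one_homothety_twistedGrenet, not_gaugeLifts_zero_homothety_twistedGrenet⟩

end

end Summit.ValiantsHypothesis.ValiantsHypothesis.Cruxes.OrbitDimensionBound.Gauge.Witness
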